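import Summits.QuantumFields.YangMills.Theorems.BalabanUVNodesSpineReadingOfRecord13CoPHKComponentSizeBlocksFreshTowerFibreVacuity
import Literature.MathematicalPhysics.QuantumFieldTheory.Balaban1983to89.Node00.Record12Measurability

/-!
# THE ONE-STEP LETTER IN LABEL CURRENCY: `Σ_{t : C ⊆ P_t} χ_{k+1}(σ s t)·ω s t = Π_{□ ∈ C} (1 − χ_□)` POINTWISE, hence the classes «every label producing the sequence
# has the cubes `C` among its new large-field cubes `P_{k+1}`» weigh at most `∫ Π_{□∈C}(1 − χ_□(avg U))·χ_k(s)·slot_k(s) dU` — what (1.79)'s new-region factor multiplies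

Cell `pub-ymgap`, YM-PLAN Track A (HUMAN RULING D-0062; width push D-0149); seat `pub-ymgap-dag-n20-d` (R134 (a) N20 NE7b s3 = the U5d ∕ `crOfRecord₁₃` lineage, its declarer)
gen 38.  `--kind proof --supports stmt-QuantumFields-27366 --as helper` (K3⁸); COUNT-NEUTRAL; THEOREMS ONLY (0 `def`).  [III] = [Balaban1988Convergent]; [LF-II] = [Balaban1989LargeFieldII].
Companion of `…BlocksFreshTowerFibreVacuity` (gen 38, p766147: LOCATED-4 — the per-history FRESH letters are degenerate wherever (T) holds), `Node00.StepWeightsOfRecord` (n02-b ∕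
def-T: labels `t = (P,Q,R,S)`, `ωOfRecord = a(P)·b(P,Q)·ζ`, `sum_aWeight`, `front_absorb`, `labelUnity_ωOfRecord`), `Node00.TStepFibreMass` (gen 37: the per-fibre Fubini form of the
𝐓-step), `Node00.Record12Measurability` (K0c: `measurable_chiFactor_of_localBg`) and n19's `…N19MGFRoadLiveSelectorTower` (the live → identity re-pin of F3's dressed tower).

WHY (LOCATED-4's repair [d]).  [LF-II] (1.79) p. 383 pays its small factor `exp(−p₀(g_j))` per NEW large-field region — in [III] §3's bookkeeping, per χ_{k+1}-cube of the label
sets `P_{k+1}` ((3.2): the cubes where the new small-field condition fails), `Q_{k+1}` ((3.3)), `R_{k+1}` ((3.16)).  The honest one-step letter on the (2.18) class weights is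
therefore LABEL-level: «the one-step extensions of the history `s` all of whose producing labels have `C ⊆ P_{k+1}`» against `s` itself.  This file proves the STRUCTURAL half
of that letter and isolates the ANALYTIC half.  Structural (§1–§2, pointwise in `(U, V′)`): by the product form of the pinned (3.2) decomposition, `Σ_{P ⊇ C} a(P)(V′) =
Π_{□∈C}(1 − χ_□(V′))` (`C ⊆` the (3.2) range), hence with (3.3)'s and ζ's unity and front-factor absorption `Σ_{t : C ⊆ P_t} χ_{k+1}(σ s t)(V′)·ω s t (U,V′) = Π_{□∈C}(1 − χ_□(V′))`,
and — labels being non-negative under `0 ≤ ζ` — the resummed step weights of the class `S_C(s) = {s′ : s′.init = s, every t with σ s t = s′ has C ⊆ P_t}` satisfy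
`Σ_{s′ ∈ S_C(s)} χ_{k+1}(s′)(V′)·w(s′)(U,V′) ≤ Π_{□∈C}(1 − χ_□(V′))`.  Transport (§3–§4, def-T's `integral_transport_piece` on the graph `V′ = avg U`):
`Σ_{s′ ∈ S_C(s)} ∫ χ_{k+1}(s′)·(𝐓-step T)(s′) ≤ ∫ Π_{□∈C}(1 − χ_□(avg U))·χ_k(s)(U)·T(s)(U) dU` for every non-negative level-`k` slot family with integrable piece at `s`.  Dressed
tower (§5): at a live-pinned Stage-9 tuple the 𝐑-step of record is the identity re-pin (n19) and the identity 𝐑-step multiplies the pre-𝐑 slot by its own ratio `∈ {0,1}`, so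
`Σ_{s′ ∈ S_C(s)} cw_{k+1}(s′) ≤ ∫ Π_{□∈C}(1 − χ_□(avg U))·χ_k(s)·slot_k(s) dU` under (H-U) and the ζ-laws.  What a supplier then owes for the label letter
`Σ_{s′ ∈ S_C(s)} cw_{k+1}(s′) ≤ δ^{|C|}·cw_k(s)` is EXACTLY the large-field suppression `∫ Π_{□∈C}(1 − χ_□(avg U))·χ_k(s)·slot_k(s) ≤ δ^{|C|}·∫ χ_k(s)·slot_k(s)` — the probability,
under the class density of the history `s`, that the (2.16) background of the averaged field violates the new small-field condition on every cube of `C`: (1.79)'s factor,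
whose printed proof is Theorem 1 [III]'s inductive form (2.21) of `slot_k` + the positivity of the quadratic forms ([LF-II] p. 383).  An ESTIMATE; nobody's theorem today; and by
LOCATED-4 (iii) its assembly to `RelWeightBound` at the live pin still meets the inheritance entropy — this file only fixes the CURRENCY.

WHAT IS HERE.  §1 [folklore] `sum_powerset_filter_superset_prod_mul_prod`; §2 `sum_ite_superset_aWeight_eq_prod`, ★ `sum_filter_chi_mul_ωOfRecord_eq_prod`, ★★
`sum_filter_chi_mul_wOfRecord_le_prod`; §3 (generic `P, G, D, avg`) ★ `sum_integral_chi_texpASucc_le_of_pointwise`; §4 ★★ `sum_labelClass_integral_chi_tstepOfRecord_le` (pre-𝐑, of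
record); §5 ★★ `sum_labelClass_classWeightOfDatum₉_succ_le_of_ppSelId` ∕ ★★★ `…_of_ppSelLive` (F3's dressed class weights at an identity- ∕ live-pinned Stage-9
tuple) and ★★★ `sum_labelClass_classWeightOfDatum₉_succ_le_of_largeFieldLetter_of_ppSelLive` (the label letter from the large-field suppression letter hLF ALONE).

HONEST FRAMING.  [bookkeeping] finite sums + Fubini on def-T's ∕ F3's objects BY NAME; hLF is a HYPOTHESIS (inhabited for no family today; (1.79)'s KIND read on the class density
of one history; NOT PRINTED in this form); NO weight is bounded, NO estimate proved; nothing of Bałaban's asserted; NE7 ∕ NE7b ∕ NE7c NOT PRINTED for `d = 4` ∕ NOT proved; no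
`Provisos₁₃CoPH` ∕ `Stage9Params.Provisos` inhabitant claimed (K0⁷ OPEN); K3⁸ v7 untouched; N19 ∕ N20 ∕ N21 ∕ N27 NOT discharged; counts UNMOVED (typed 28∕28 · discharged 8∕27); one
finite four-torus programme at fixed `ε` — NOT ℝ⁴, NOT OS, NOT a mass gap, NOT the Clay problem.  No `def`, no `instance`, no `notation`, no `sorry`; no decl below carries a cite tag.
-/

noncomputable section

open MeasureTheory
open scoped BigOperators
open Finset

namespace YMDAG.UVSplit

open Literature.MathematicalPhysics.QuantumFieldTheory.Balaban1983to89
open Literature.MathematicalPhysics.QuantumFieldTheory.Balaban1983to89.T4Continuum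
open Literature.MathematicalPhysics.QuantumFieldTheory.Balaban1983to89.T4AveragingDisintegration
open Literature.MathematicalPhysics.QuantumFieldTheory.Balaban1983to89.Node00
open Literature.MathematicalPhysics.QuantumFieldTheory.Balaban1983to89.B14.Eq218Concrete
open Literature.MathematicalPhysics.QuantumFieldTheory.Balaban1983to89.B14.Sect3Decomp
open Literature.MathematicalPhysics.QuantumFieldTheory.Balaban1983to89.T4FiniteEpsInhabited
open Summit.QuantumFields.YangMills.BalabanUVNodes.N19MGFRoadLiveSelectorTower (classWeightOfDatum₉_ppSelLive_eq_ppSelId dressedSlotsOfDatum₉_ppSelLive_eq_ppSelId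
  measurable_dressedSlotsOfDatum₉ dressedSlotsOfDatum₉_nonneg)

/-! ## §1 [folklore] The superset sums of a product decomposition of unity -/

/-- [folklore] For `C ⊆ cubes` and any `f`: `Σ_{Pk ⊆ cubes, C ⊆ Pk} (Π_{cubes ∖ Pk} f)·(Π_{Pk} (1 − f)) = Π_{c ∈ C} (1 − f c)` — expand `Π_{c ∈ cubes} ((1 − f c) + [c ∉ C]·f c)` by
`Finset.prod_add`. -/
theorem sum_powerset_filter_superset_prod_mul_prod {ι : Type*} [DecidableEq ι] (cubes C : Finset ι) (hC : C ⊆ cubes) (f : ι → ℝ) :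
    ∑ Pk ∈ cubes.powerset.filter (fun Pk => C ⊆ Pk), (∏ c ∈ cubes \ Pk, f c) * ∏ c ∈ Pk, (1 - f c) = ∏ c ∈ C, (1 - f c) := by
  have hexp := Finset.prod_add (s := cubes) (f := fun c => 1 - f c) (g := fun c => if c ∈ C then (0 : ℝ) else f c)
  have hlhs : ∏ c ∈ cubes, ((1 - f c) + if c ∈ C then (0 : ℝ) else f c) = ∏ c ∈ C, (1 - f c) := by
    rw [← Finset.prod_sdiff hC]
    have h1 : ∏ c ∈ cubes \ C, ((1 - f c) + if c ∈ C then (0 : ℝ) else f c) = 1 := Finset.prod_eq_one fun c hc => by rw [if_neg (Finset.mem_sdiff.1 hc).2]; ring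
    have h2 : ∏ c ∈ C, ((1 - f c) + if c ∈ C then (0 : ℝ) else f c) = ∏ c ∈ C, (1 - f c) := Finset.prod_congr rfl fun c hc => by rw [if_pos hc, add_zero]
    rw [h1, h2, one_mul]
  rw [hlhs] at hexp
  rw [hexp, Finset.sum_filter]
  refine Finset.sum_congr rfl fun Pk hPk => ?_
  by_cases hCP : C ⊆ Pk
  · rw [if_pos hCP, mul_comm]
    congr 1
    exact Finset.prod_congr rfl fun c hc => by
      rw [if_neg (fun hcC => (Finset.mem_sdiff.1 hc).2 (hCP hcC))]
  · rw [if_neg hCP]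
    obtain ⟨c, hcC, hcP⟩ := Finset.not_subset.1 hCP
    exact (mul_eq_zero_of_right _ (Finset.prod_eq_zero (Finset.mem_sdiff.2 ⟨hC hcC, hcP⟩) (by rw [if_pos hcC]))).symm

/-! ## §2 Of record, pointwise in `(U, V′)`: the label sums over `{t : C ⊆ P_t}` -/

section LabelSums

variable (F : T4Family) (N : ℕ) [NeZero N] (ν : Stage7Numerics) (M : ℕ) (A₁ : ℝ) (p : B12.RunParams) (g : ℕ → ℝ) (k : ℕ)

/-- `Σ_{P ⊇ C} a(P)(V′) = Π_{□ ∈ C} (1 − χ_□(V′))` for a set `C` of χ_{k+1}-cubes of the (3.2) range `cubes32 s`: the pinned (3.2) label weight is the indicator of `P ⊆ cubes32 s` times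
`Π_{cubes32 ∖ P} χ_□ · Π_P (1 − χ_□)` (`chiNext_sect3DataOfRecord`; `chiNextc` by `rfl`). [bookkeeping] -/
theorem sum_ite_superset_aWeight_eq_prod (s : SeqOfRecord F ν M g p.K k) (C : Finset (Iχ F ν p g k)) (hC : C ⊆ cubes32 F ν M p g k s)
    (V' : GaugeField (F.P p.K) (k + 1) (SU N)) :
    (∑ Pl : Finset (Iχ F ν p g k), if C ⊆ Pl then aWeight F N ν M p g k s Pl V' else 0) = ∏ c ∈ C, (1 - chiFactor F N ν p g k c V') := by
  classical
  have key : ∀ Pl : Finset (Iχ F ν p g k), (if C ⊆ Pl then aWeight F N ν M p g k s Pl V' else 0) =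
      if Pl ∈ (cubes32 F ν M p g k s).powerset.filter (fun Pk => C ⊆ Pk) then
        (∏ c ∈ cubes32 F ν M p g k s \ Pl, chiFactor F N ν p g k c V') * ∏ c ∈ Pl, (1 - chiFactor F N ν p g k c V') else 0 := by
    intro Pl
    simp only [Finset.mem_filter, Finset.mem_powerset]
    by_cases hCP : C ⊆ Pl
    · by_cases hP : Pl ⊆ cubes32 F ν M p g k s
      · rw [if_pos hCP, if_pos ⟨hP, hCP⟩, aWeight, if_pos hP, chiNext_sect3DataOfRecord]
        rfl
      · rw [if_pos hCP, if_neg (fun h => hP h.1), aWeight, if_neg hP]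
    · rw [if_neg hCP, if_neg (fun h => hCP h.2)]
  rw [Finset.sum_congr rfl (fun Pl _ => key Pl), ← Finset.sum_filter, Finset.filter_mem_eq_inter, Finset.univ_inter]
  exact sum_powerset_filter_superset_prod_mul_prod (cubes32 F ν M p g k s) C hC (fun c => chiFactor F N ν p g k c V')

open scoped Classical in
/-- ★ **THE LABEL SUM OVER `{t : C ⊆ P_t}` IS `Π_{□∈C}(1 − χ_□)`, POINTWISE**: under the ζ-unity law, for `C ⊆ cubes32 s`,
`Σ_{t : C ⊆ t.1} χ_{k+1}(σ s t)(V′) · ω s t (U, V′) = Π_{□ ∈ C} (1 − χ_□(V′))` (front absorption, then (3.3)'s and ζ's unity label by label, then `sum_ite_superset_aWeight_eq_prod`).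
With `C = ∅` this is `labelUnity_ωOfRecord`. [bookkeeping] -/
theorem sum_filter_chi_mul_ωOfRecord_eq_prod {ζ : ZetaOfRecord F N ν M} (hζ : IsZetaUnity F N ν M ζ) (s : SeqOfRecord F ν M g p.K k)
    (C : Finset (Iχ F ν p g k)) (hC : C ⊆ cubes32 F ν M p g k s) (U : GaugeField (F.P p.K) k (SU N)) (V' : GaugeField (F.P p.K) (k + 1) (SU N)) :
    ∑ t ∈ Finset.univ.filter (fun t : LbOfRecord F ν p g k => C ⊆ t.1),
        chiSeqOfRecord F N ν M g p.K (k + 1) (σOfRecord F ν M p g k s t) V' * ωOfRecord F N ν M p g k A₁ ζ s t U V' =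
      ∏ c ∈ C, (1 - chiFactor F N ν p g k c V') := by
  classical
  have key : ∀ t : LbOfRecord F ν p g k,
      chiSeqOfRecord F N ν M g p.K (k + 1) (σOfRecord F ν M p g k s t) V' * ωOfRecord F N ν M p g k A₁ ζ s t U V' =
        aWeight F N ν M p g k s t.1 V' * (bWeight F N ν M p g k A₁ s t.1 t.2.1 U V' * ζ p g k s t.1 t.2.1 t.2.2 U V') := by
    intro t
    rw [ωOfRecord, ← mul_assoc, ← mul_assoc, front_absorb, mul_assoc]
  have hz : ∀ Pl Ql : Finset (Iχ F ν p g k), ∑ RS, ζ p g k s Pl Ql RS U V' = 1 := fun Pl Ql => hζ p g k s Pl Ql U V'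
  rw [Finset.sum_filter]
  calc ∑ t : LbOfRecord F ν p g k, (if C ⊆ t.1 then
          chiSeqOfRecord F N ν M g p.K (k + 1) (σOfRecord F ν M p g k s t) V' * ωOfRecord F N ν M p g k A₁ ζ s t U V' else 0)
      = ∑ t : LbOfRecord F ν p g k, (if C ⊆ t.1 then
          aWeight F N ν M p g k s t.1 V' * (bWeight F N ν M p g k A₁ s t.1 t.2.1 U V' * ζ p g k s t.1 t.2.1 t.2.2 U V') else 0) :=
        Finset.sum_congr rfl fun t _ => by rw [key t]
    _ = ∑ Pl : Finset (Iχ F ν p g k), ∑ QRS : Finset (Iχ F ν p g k) × (Finset (Iχ F ν p g k) × Finset (Iχ F ν p g k)), (if C ⊆ Pl then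
          aWeight F N ν M p g k s Pl V' * (bWeight F N ν M p g k A₁ s Pl QRS.1 U V' * ζ p g k s Pl QRS.1 QRS.2 U V') else 0) := by
        rw [Fintype.sum_prod_type]
    _ = ∑ Pl : Finset (Iχ F ν p g k), (if C ⊆ Pl then aWeight F N ν M p g k s Pl V' else 0) := by
        refine Finset.sum_congr rfl fun Pl _ => ?_
        by_cases hCP : C ⊆ Pl
        · simp only [if_pos hCP]
          rw [← Finset.mul_sum, Fintype.sum_prod_type]
          simp only [← Finset.mul_sum, hz, mul_one, sum_bWeight]
        · simp only [if_neg hCP, Finset.sum_const_zero]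
    _ = ∏ c ∈ C, (1 - chiFactor F N ν p g k c V') := sum_ite_superset_aWeight_eq_prod F N ν M p g k s C hC V'

open scoped Classical in
/-- ★★ **THE RESUMMED STEP WEIGHTS OF THE LABEL CLASS `S_C(s)` ARE AT MOST `Π_{□∈C}(1 − χ_□)`, POINTWISE.**  `S_C(s)` = the length-`(k+1)` sequences `s′` with `s′.init = s` all of
whose producing labels `t` (`σOfRecord … s t = s′`) have `C ⊆ P_t`; under ζ-unity and `0 ≤ ζ` (labels weigh `≥ 0`), `Σ_{s′ ∈ S_C(s)} χ_{k+1}(s′)(V′)·w(s′)(U,V′) ≤ Π_{□∈C}(1 − χ_□(V′))`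
(resummation fibrewise over the index map, the producing labels of `S_C(s)` lie in `{t : C ⊆ P_t}`). [bookkeeping] -/
theorem sum_filter_chi_mul_wOfRecord_le_prod {ζ : ZetaOfRecord F N ν M} (hζ : IsZetaUnity F N ν M ζ) (hζ0 : ∀ p g k s Pl Ql RS U V', 0 ≤ ζ p g k s Pl Ql RS U V')
    (s : SeqOfRecord F ν M g p.K k) (C : Finset (Iχ F ν p g k)) (hC : C ⊆ cubes32 F ν M p g k s)
    (U : GaugeField (F.P p.K) k (SU N)) (V' : GaugeField (F.P p.K) (k + 1) (SU N)) :
    ∑ s' ∈ Finset.univ.filter (fun s' : SeqOfRecord F ν M g p.K (k + 1) =>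
        s'.init = s ∧ ∀ t : LbOfRecord F ν p g k, σOfRecord F ν M p g k s t = s' → C ⊆ t.1),
        chiSeqOfRecord F N ν M g p.K (k + 1) s' V' * wOfRecord F N ν M A₁ ζ p g k s' U V' ≤ ∏ c ∈ C, (1 - chiFactor F N ν p g k c V') := by
  classical
  set S := Finset.univ.filter (fun s' : SeqOfRecord F ν M g p.K (k + 1) =>
    s'.init = s ∧ ∀ t : LbOfRecord F ν p g k, σOfRecord F ν M p g k s t = s' → C ⊆ t.1) with hS
  set gl : LbOfRecord F ν p g k → ℝ := fun t =>
    chiSeqOfRecord F N ν M g p.K (k + 1) (σOfRecord F ν M p g k s t) V' * ωOfRecord F N ν M p g k A₁ ζ s t U V' with hgl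
  -- each member's term is the sum of its producing labels' terms
  have hmem : ∀ s' ∈ S, chiSeqOfRecord F N ν M g p.K (k + 1) s' V' * wOfRecord F N ν M A₁ ζ p g k s' U V' =
      ∑ t ∈ Finset.univ.filter (fun t : LbOfRecord F ν p g k => σOfRecord F ν M p g k s t = s'), gl t := by
    intro s' hs'
    rw [wOfRecord_apply, resumWeights, (Finset.mem_filter.1 hs').2.1, Finset.mul_sum]
    exact Finset.sum_congr rfl fun t ht => by rw [hgl]; simp only; rw [(Finset.mem_filter.1 ht).2]
  rw [Finset.sum_congr rfl hmem]
  -- regroup fibrewise over the index map: the producing labels of `S` are the labels `t` with `σ s t ∈ S`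
  have hfib : ∑ s' ∈ S, ∑ t ∈ Finset.univ.filter (fun t : LbOfRecord F ν p g k => σOfRecord F ν M p g k s t = s'), gl t =
      ∑ t ∈ Finset.univ.filter (fun t : LbOfRecord F ν p g k => σOfRecord F ν M p g k s t ∈ S), gl t := by
    rw [← Finset.sum_fiberwise_of_maps_to (s := Finset.univ.filter (fun t : LbOfRecord F ν p g k => σOfRecord F ν M p g k s t ∈ S)) (t := S)
      (g := fun t => σOfRecord F ν M p g k s t) (fun t ht => (Finset.mem_filter.1 ht).2)]
    refine Finset.sum_congr rfl fun s' hs' => Finset.sum_congr ?_ (fun _ _ => rfl)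
    ext t
    simp only [Finset.mem_filter, Finset.mem_univ, true_and]
    exact ⟨fun h => ⟨by rw [h]; exact hs', h⟩, fun h => h.2⟩
  rw [hfib]
  -- those labels have `C ⊆ P_t`, and label terms are non-negative
  have hsub : Finset.univ.filter (fun t : LbOfRecord F ν p g k => σOfRecord F ν M p g k s t ∈ S) ⊆
      Finset.univ.filter (fun t : LbOfRecord F ν p g k => C ⊆ t.1) := by
    intro t ht
    have h := (Finset.mem_filter.1 ht).2
    rw [hS, Finset.mem_filter] at h
    exact Finset.mem_filter.2 ⟨Finset.mem_univ _, h.2.2 t rfl⟩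
  refine (Finset.sum_le_sum_of_subset_of_nonneg hsub fun t _ _ => ?_).trans
    (le_of_eq (sum_filter_chi_mul_ωOfRecord_eq_prod F N ν M A₁ p g k hζ s C hC U V'))
  exact mul_nonneg (chiSeqOfRecord_nonneg F N ν M g p.K (k + 1) _ V') (ωOfRecord_nonneg F N ν M p g k A₁ hζ0 s t U V')

end LabelSums

/-! ## §3 Generic: a sub-family of one `init`-fibre of the 𝐓-step under a pointwise bound on the graph -/

section Generic

variable {P : Params} {G : Type*} [GaugeGroup G] [MeasurableSpace G] [HaarData G] [StandardBorelSpace G]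
variable {α : Type*} {D : ℕ → Set (Set α)} {k : ℕ}
variable {avg : GaugeField P k G → GaugeField P (k + 1) G}

/-- ★ **A SUB-FAMILY OF ONE `init`-FIBRE OF THE 𝐓-STEP, UNDER A POINTWISE BOUND ON THE GRAPH.**  For a measurable averaging with `HaarAC`, a level-`k` sequence `s` with
NON-NEGATIVE integrable piece `χ_k(s)·T(s)`, bounded jointly measurable weights, bounded measurable new front factors, a finite family `S` of one-step extensions of `s`, and a
bounded measurable `f` with `Σ_{s′ ∈ S} χ_{k+1}(s′)(avg U)·w(s′)(U, avg U) ≤ f(avg U)` for every `U`: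
`Σ_{s′ ∈ S} ∫ χ_{k+1}(s′)·texpASucc(s′) ≤ ∫ χ_k(s)(U)·T(s)(U)·f(avg U) dU` (def-T's `integral_transport_piece` per member, then the pointwise bound). [bookkeeping] -/
theorem sum_integral_chi_texpASucc_le_of_pointwise (havg : Measurable avg) (hac : HaarAC avg) (χk T : Seq D k → Density P k G)
    (χk1 : Seq D (k + 1) → Density P (k + 1) G) (w : Seq D (k + 1) → GaugeField P k G → GaugeField P (k + 1) G → ℝ)
    (s : Seq D k) (hT : Integrable (fun U => χk s U * T s U) (fieldMeasure P k G)) (hT0 : ∀ U, 0 ≤ χk s U * T s U)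
    (hw : ∀ s', Measurable (fun z : GaugeField P (k + 1) G × GaugeField P k G => w s' z.2 z.1))
    (hwb : ∀ s' U V', |w s' U V'| ≤ 1) (hχ : ∀ s', Measurable (χk1 s')) (hχb : ∀ s' V', |χk1 s' V'| ≤ 1)
    (S : Finset (Seq D (k + 1))) (hS : ∀ s' ∈ S, s'.init = s)
    {f : GaugeField P (k + 1) G → ℝ} (hf : Measurable f) (hfC : ∃ C, ∀ V, |f V| ≤ C)
    (hpt : ∀ U, ∑ s' ∈ S, χk1 s' (avg U) * w s' U (avg U) ≤ f (avg U)) :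
    ∑ s' ∈ S, ∫ V, χk1 s' V * texpASucc avg χk T w s' V ∂(fieldMeasure P (k + 1) G)
      ≤ ∫ U, χk s U * T s U * f (avg U) ∂(fieldMeasure P k G) := by
  classical
  obtain ⟨C, hC⟩ := hfC
  have hb : ∀ s', Measurable (fun z : GaugeField P (k + 1) G × GaugeField P k G => w s' z.2 z.1 * χk1 s' z.1) :=
    fun s' => (hw s').mul ((hχ s').comp measurable_fst)
  have hbC : ∀ s' (z : GaugeField P (k + 1) G × GaugeField P k G), ‖w s' z.2 z.1 * χk1 s' z.1‖ ≤ 1 := fun s' z => by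
    rw [Real.norm_eq_abs, abs_mul, ← one_mul (1 : ℝ)]; exact mul_le_mul (hwb _ _ _) (hχb _ _) (abs_nonneg _) zero_le_one
  have hTs : ∀ s' ∈ S, Integrable (fun U => χk s'.init U * T s'.init U) (fieldMeasure P k G) := fun s' hs' => by rw [hS s' hs']; exact hT
  have e : ∀ s' V, χk1 s' V * texpASucc avg χk T w s' V =
      (avgDensity avg V : ℝ) * ∫ U, (χk s'.init U * T s'.init U) * (w s' U V * χk1 s' V) ∂(avgKernel avg V) := by
    intro s' V
    have : ∫ U, (χk s'.init U * T s'.init U) * (w s' U V * χk1 s' V) ∂(avgKernel avg V)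
        = (∫ U, w s' U V * (χk s'.init U * T s'.init U) ∂(avgKernel avg V)) * χk1 s' V := by
      rw [← integral_mul_const]; exact integral_congr_ae (ae_of_all _ fun U => by ring)
    rw [this, texpASucc_apply]; ring
  have hstep : ∑ s' ∈ S, ∫ V, χk1 s' V * texpASucc avg χk T w s' V ∂(fieldMeasure P (k + 1) G) =
      ∫ U, ∑ s' ∈ S, (χk s'.init U * T s'.init U) * (w s' U (avg U) * χk1 s' (avg U)) ∂(fieldMeasure P k G) := by
    calc ∑ s' ∈ S, ∫ V, χk1 s' V * texpASucc avg χk T w s' V ∂(fieldMeasure P (k + 1) G)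
        = ∑ s' ∈ S, ∫ V, (avgDensity avg V : ℝ) *
            ∫ U, (χk s'.init U * T s'.init U) * (w s' U V * χk1 s' V) ∂(avgKernel avg V) ∂(fieldMeasure P (k + 1) G) :=
          Finset.sum_congr rfl fun s' _ => integral_congr_ae (ae_of_all _ (e s'))
      _ = ∑ s' ∈ S, ∫ U, (χk s'.init U * T s'.init U) * (w s' U (avg U) * χk1 s' (avg U)) ∂(fieldMeasure P k G) :=
          Finset.sum_congr rfl fun s' hs' => integral_transport_piece havg hac (hTs s' hs') (hb s') (hbC s')
      _ = ∫ U, ∑ s' ∈ S, (χk s'.init U * T s'.init U) * (w s' U (avg U) * χk1 s' (avg U)) ∂(fieldMeasure P k G) :=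
          (integral_finsetSum _ fun s' hs' => integrable_graph_piece havg (hTs s' hs') (hb s') (hbC s')).symm
  rw [hstep]
  have hfi : Integrable (fun U => χk s U * T s U * f (avg U)) (fieldMeasure P k G) :=
    hT.mul_bdd ((hf.comp havg).aestronglyMeasurable) (Filter.Eventually.of_forall fun U => by rw [Real.norm_eq_abs]; exact hC _)
  refine integral_mono (integrable_finsetSum _ fun s' hs' => integrable_graph_piece havg (hTs s' hs') (hb s') (hbC s')) hfi fun U => ?_
  have hrew : ∑ s' ∈ S, (χk s'.init U * T s'.init U) * (w s' U (avg U) * χk1 s' (avg U)) =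
      (χk s U * T s U) * ∑ s' ∈ S, χk1 s' (avg U) * w s' U (avg U) := by
    rw [Finset.mul_sum]; exact Finset.sum_congr rfl fun s' hs' => by rw [hS s' hs']; ring
  show ∑ s' ∈ S, (χk s'.init U * T s'.init U) * (w s' U (avg U) * χk1 s' (avg U)) ≤ χk s U * T s U * f (avg U)
  rw [hrew]
  exact mul_le_mul_of_nonneg_left (hpt U) (hT0 U)

end Generic

/-! ## §4 Of record, pre-𝐑: the label class `S_C(s)` of the 𝐓-step weighs at most `∫ Π_{□∈C}(1 − χ_□(avg U))·χ_k(s)·T(s)` -/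

section PreR

variable (F : T4Family) (N : ℕ) [NeZero N] (ν : Stage7Numerics) (M : ℕ) (A₁ : ℝ)

open scoped Classical in
/-- ★★ **THE LABEL CLASS OF THE 𝐓-STEP OF RECORD, PRE-𝐑** (`k < K`): for a level-`k` slot family `T ≥ 0` with integrable piece at `s`, jointly measurable weights (displayed, (O4)),
ζ-unity, `Σ|ζ| ≤ 1`, `0 ≤ ζ`, measurable χ-factors and front factors (displayed; (H-U) supplies them), and `C ⊆ cubes32 s`:
`Σ_{s′ ∈ S_C(s)} ∫ χ_{k+1}(s′)·tstepOfRecord (wOfRecord A₁ ζ) … T s′ ≤ ∫ (Π_{□∈C}(1 − χ_□(avg U)))·χ_k(s)(U)·T(s)(U) dU`. [bookkeeping] -/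
theorem sum_labelClass_integral_chi_tstepOfRecord_le {ζ : ZetaOfRecord F N ν M} (hζ : IsZetaUnity F N ν M ζ) (hζa : IsZetaAbsLeOne F N ν M ζ)
    (hζ0 : ∀ p g k s Pl Ql RS U V', 0 ≤ ζ p g k s Pl Ql RS U V') (p : B12.RunParams) (g : ℕ → ℝ) (k : ℕ) (hk : k < p.K)
    (T : SeqOfRecord F ν M g p.K k → Density (F.P p.K) k (SU N)) (hT0' : ∀ s U, 0 ≤ T s U) (s : SeqOfRecord F ν M g p.K k)
    (hT : Integrable (fun U => chiSeqOfRecord F N ν M g p.K k s U * T s U) (fieldMeasure (F.P p.K) k (SU N)))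
    (hw : ∀ s', Measurable (fun z : GaugeField (F.P p.K) (k + 1) (SU N) × GaugeField (F.P p.K) k (SU N) => wOfRecord F N ν M A₁ ζ p g k s' z.2 z.1))
    (hχ : ∀ s', Measurable (chiSeqOfRecord F N ν M g p.K (k + 1) s')) (hχc : ∀ c : Iχ F ν p g k, Measurable (chiFactor F N ν p g k c))
    (C : Finset (Iχ F ν p g k)) (hC : C ⊆ cubes32 F ν M p g k s) :
    ∑ s' ∈ Finset.univ.filter (fun s' : SeqOfRecord F ν M g p.K (k + 1) =>
        s'.init = s ∧ ∀ t : LbOfRecord F ν p g k, σOfRecord F ν M p g k s t = s' → C ⊆ t.1),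
        ∫ V, chiSeqOfRecord F N ν M g p.K (k + 1) s' V * tstepOfRecord F N ν M (wOfRecord F N ν M A₁ ζ) p g k T s' V ∂(fieldMeasure (F.P p.K) (k + 1) (SU N))
      ≤ ∫ U, chiSeqOfRecord F N ν M g p.K k s U * T s U * ∏ c ∈ C, (1 - chiFactor F N ν p g k c ((avOfRecord F N p.K k).avg U))
          ∂(fieldMeasure (F.P p.K) k (SU N)) := by
  refine sum_integral_chi_texpASucc_le_of_pointwise (avOfRecord_measurable F N p.K k) (avOfRecord_haarAC F N p.K k hk) _ T _ _ s hT
    (fun U => mul_nonneg (chiSeqOfRecord_nonneg F N ν M g p.K k s U) (hT0' s U)) hw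
    (fun s' U V' => abs_wOfRecord_le_one F N ν M A₁ hζa p g k s' U V') hχ (fun s' V' => abs_chiSeqOfRecord_le_one F N ν M g p.K (k + 1) s' V') _
    (fun s' hs' => (Finset.mem_filter.1 hs').2.1) (f := fun V' => ∏ c ∈ C, (1 - chiFactor F N ν p g k c V'))
    (Finset.measurable_prod _ fun c _ => measurable_const.sub (hχc c)) ⟨1, fun V' => ?_⟩ fun U => ?_
  · rw [abs_of_nonneg (Finset.prod_nonneg fun c _ => sub_nonneg.2 (chiFactor_le_one F N ν p g k c V'))]
    exact Finset.prod_le_one (fun c _ => sub_nonneg.2 (chiFactor_le_one F N ν p g k c V')) fun c _ => sub_le_self _ (chiFactor_nonneg F N ν p g k c V')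
  · exact sum_filter_chi_mul_wOfRecord_le_prod F N ν M A₁ p g k hζ hζ0 s C hC U _

end PreR

/-! ## §5 F3's dressed class weights: the label class at an identity-pinned tuple, at a live-pinned tuple, and the letter left to the large-field suppression -/

section Dressed

variable {F : T4Family} {N : ℕ} [NeZero N]

open scoped Classical in
/-- ★ **THE IDENTITY 𝐑-STEP NEVER INCREASES A NON-NEGATIVE SLOT**: at the identity selector `ppSelIdOfRecord` the 𝐑-stepped slot is the slot times its own fibre-integral
ratio `∫⌈ t_s ∕ ∫⌈ t_s ∈ {0, 1}` (`rstepOfSel_id_TexpA`), hence `≤` the slot. [bookkeeping] -/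
theorem rstepSlotOfRecord_ppSelId_le (ν : Stage7Numerics) (τ : TowerNumerics) (p : B12.RunParams) (g : ℕ → ℝ) (k : ℕ)
    (f : TexpASlot F N ν τ.M p g k) (hf : ∀ s V, 0 ≤ f s V) (s : SeqOfRecord F ν τ.M g p.K k) (V : GaugeField (F.P p.K) k (SU N)) :
    rstepSlotOfRecord F N ν τ (ppSelIdOfRecord F ν τ.M) p g k f s V ≤ f s V := by
  -- unfold def-R's slot operation in place (its fibre bond sets carry def-R's own decidability instances: never restate them)
  show rstepSlot F N ν τ p g k (ppSelIdOfRecord F ν τ.M p g k) f s V ≤ f s V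
  unfold rstepSlot
  refine (le_of_eq (rstepOfSel_id_TexpA N (Classical.decEq _) (sliceOfRecord F N ν τ.M p g k f) _ s V)).trans ?_
  exact mul_le_of_le_one_right (hf s V) (div_self_le_one _)

open scoped Classical in
/-- ★★ **THE LABEL CLASS OF THE DRESSED TOWER AT AN IDENTITY-PINNED STAGE-9 TUPLE.**  For `ϑ` with `ϑ.ppSel = ppSelIdOfRecord`, a datum with measurable averaging, `g 0 = g₀ p.K`,
(H-U), the ζ-laws (unity, `Σ|ζ| ≤ 1`, joint measurability, `0 ≤ ζ`), `k < p.K`, a level-`k` sequence `s`, `C ⊆ cubes32 s`, source `t`: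
`Σ_{s′ ∈ S_C(s)} cw_{k+1}(s′) ≤ ∫ χ_k(s)(U)·slot^{t}_k(s)(U)·Π_{□∈C}(1 − χ_□(avg U)) dU`.  The identity 𝐑-step multiplies the pre-𝐑 slot by its own fibre-integral ratio `∈ {0, 1}`
(`rstepOfSel_id_TexpA`), so each `cw_{k+1}(s′)` is at most the integral of the pre-𝐑 piece (integrable by K0c's `integrable_tstepOfRecord` and gen 37's
`integrable_dressedSlotsOfDatum₉_of_ppSelId`), and §4 applies to the pre-𝐑 family. [bookkeeping] -/
theorem sum_labelClass_classWeightOfDatum₉_succ_le_of_ppSelId (ϑ : Stage9Params F N) (hid : ϑ.ppSel = ppSelIdOfRecord F ϑ.ν ϑ.τ9.M)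
    (hU : LocalBgMeasurable F N ϑ.ν) (hζu : IsZetaUnity F N ϑ.ν ϑ.τ9.M ϑ.ζ) (hζa : IsZetaAbsLeOne F N ϑ.ν ϑ.τ9.M ϑ.ζ)
    (hζm : ZetaMeasurable F N ϑ.ζ) (hζ0 : ∀ p g k s Pl Ql RS U V', 0 ≤ ϑ.ζ p g k s Pl Ql RS U V')
    (D : FiniteEpsData F (SU N)) (hD : D.AvgMeasurable) (g₀ : ℕ → ℝ) (os : List (ULoop F)) (p : B12.RunParams) (g : ℕ → ℝ) (hg : g 0 = g₀ p.K)
    (k : ℕ) (hk : k < p.K) (t : ℝ) (s : SeqOfRecord F ϑ.ν ϑ.τ9.M g p.K k) (C : Finset (Iχ F ϑ.ν p g k)) (hC : C ⊆ cubes32 F ϑ.ν ϑ.τ9.M p g k s) :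
    ∑ s' ∈ Finset.univ.filter (fun s' : SeqOfRecord F ϑ.ν ϑ.τ9.M g p.K (k + 1) =>
        s'.init = s ∧ ∀ lb : LbOfRecord F ϑ.ν p g k, σOfRecord F ϑ.ν ϑ.τ9.M p g k s lb = s' → C ⊆ lb.1),
        classWeightOfDatum₉ F N ϑ D g₀ os p g (k + 1) t s'
      ≤ ∫ U, chiSeqOfRecord F N ϑ.ν ϑ.τ9.M g p.K k s U * dressedSlotsOfDatum₉ F N ϑ D g₀ os t p g k s U *
          ∏ c ∈ C, (1 - chiFactor F N ϑ.ν p g k c ((avOfRecord F N p.K k).avg U)) ∂(fieldMeasure (F.P p.K) k (SU N)) := by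
  -- record suppliers, all levels
  have hw0 : ∀ k s' U V', 0 ≤ wOfRecord₉ F N ϑ p g k s' U V' := fun k s' U V' => wOfRecord_nonneg F N ϑ.ν ϑ.τ9.M p g k ϑ.A₁ hζ0 s' U V'
  have hwb : ∀ k s' U V', |wOfRecord₉ F N ϑ p g k s' U V'| ≤ 1 := fun k s' U V' => abs_wOfRecord_le_one F N ϑ.ν ϑ.τ9.M ϑ.A₁ hζa p g k s' U V'
  have hwm : ∀ k s', Measurable (fun z : GaugeField (F.P p.K) (k + 1) (SU N) × GaugeField (F.P p.K) k (SU N) => wOfRecord₉ F N ϑ p g k s' z.2 z.1) :=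
    fun k s' => measurable_wOfRecord_of_localBg hU ϑ.τ9.M ϑ.A₁ hζm p g k s'
  have hχm : ∀ k s, Measurable (chiSeqOfRecord F N ϑ.ν ϑ.τ9.M g p.K k s) := fun k s => measurable_chiSeqOfRecord_of_localBg hU ϑ.τ9.M g p.K k s
  have hχb : ∀ k (s : SeqOfRecord F ϑ.ν ϑ.τ9.M g p.K k), ∀ᵐ U ∂(fieldMeasure (F.P p.K) k (SU N)), ‖chiSeqOfRecord F N ϑ.ν ϑ.τ9.M g p.K k s U‖ ≤ 1 :=
    fun k s => ae_of_all _ fun U => by rw [Real.norm_eq_abs]; exact abs_chiSeqOfRecord_le_one F N ϑ.ν ϑ.τ9.M g p.K k s U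
  have hχc : ∀ c : Iχ F ϑ.ν p g k, Measurable (chiFactor F N ϑ.ν p g k c) := fun c => measurable_chiFactor_of_localBg hU p g k c
  -- integrability of the dressed pieces at the identity pin (no (H-h)), all levels `≤ K`; non-negativity
  have hTint : ∀ k, k ≤ p.K → ∀ s : SeqOfRecord F ϑ.ν ϑ.τ9.M g p.K k,
      Integrable (fun U => chiSeqOfRecord F N ϑ.ν ϑ.τ9.M g p.K k s U * dressedSlotsOfDatum₉ F N ϑ D g₀ os t p g k s U) (fieldMeasure (F.P p.K) k (SU N)) :=
    fun k hk s => (integrable_dressedSlotsOfDatum₉_of_ppSelId ϑ hid D hD g₀ os p g hg hw0 hwb hwm hχm t k hk s).bdd_mul (hχm k s).aestronglyMeasurable (hχb k s)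
  have hd0 := dressedSlotsOfDatum₉_nonneg F N ϑ D g₀ os p g hw0 t
  -- the slot recursion of record; each post-𝐑 class weight at the identity pin is at most its pre-𝐑 piece's integral
  have hrec : dressedSlotsOfDatum₉ F N ϑ D g₀ os t p g (k + 1) =
      rstepSlotOfRecord F N ϑ.ν ϑ.τ9 ϑ.ppSel p g (k + 1)
        (tstepOfRecord F N ϑ.ν ϑ.τ9.M (wOfRecord₉ F N ϑ) p g k (dressedSlotsOfDatum₉ F N ϑ D g₀ os t p g k)) :=
    texpAOfRecordFrom_succ F N ϑ.ν ϑ.τ9.M _ (wOfRecord₉ F N ϑ) (rstepSlotOfRecord F N ϑ.ν ϑ.τ9 ϑ.ppSel) p g k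
  have hle : ∀ s' : SeqOfRecord F ϑ.ν ϑ.τ9.M g p.K (k + 1), classWeightOfDatum₉ F N ϑ D g₀ os p g (k + 1) t s' ≤
      ∫ V, chiSeqOfRecord F N ϑ.ν ϑ.τ9.M g p.K (k + 1) s' V *
        tstepOfRecord F N ϑ.ν ϑ.τ9.M (wOfRecord₉ F N ϑ) p g k (dressedSlotsOfDatum₉ F N ϑ D g₀ os t p g k) s' V ∂(fieldMeasure (F.P p.K) (k + 1) (SU N)) := by
    intro s'
    have hint' := (integrable_tstepOfRecord F N ϑ.ν ϑ.τ9.M hk (hwm k) (hwb k) (hTint k hk.le) s').bdd_mul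
      (hχm (k + 1) s').aestronglyMeasurable (hχb (k + 1) s')
    unfold classWeightOfDatum₉
    refine integral_mono_of_nonneg (ae_of_all _ fun V => mul_nonneg (chiSeqOfRecord_nonneg F N ϑ.ν ϑ.τ9.M g p.K (k + 1) s' V) (hd0 (k + 1) s' V))
      hint' (ae_of_all _ fun V => ?_)
    refine mul_le_mul_of_nonneg_left ?_ (chiSeqOfRecord_nonneg F N ϑ.ν ϑ.τ9.M g p.K (k + 1) s' V)
    rw [hrec, hid]
    exact rstepSlotOfRecord_ppSelId_le ϑ.ν ϑ.τ9 p g (k + 1) _ (tstepOfRecord_nonneg F N ϑ.ν ϑ.τ9.M (hw0 k) (hd0 k)) s' V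
  refine (Finset.sum_le_sum fun s' _ => hle s').trans ?_
  exact sum_labelClass_integral_chi_tstepOfRecord_le F N ϑ.ν ϑ.τ9.M ϑ.A₁ (ζ := ϑ.ζ) hζu hζa hζ0 p g k hk
    (dressedSlotsOfDatum₉ F N ϑ D g₀ os t p g k) (fun s U => hd0 k s U) s (hTint k hk.le s) (hwm k) (hχm (k + 1)) hχc C hC

open scoped Classical in
/-- ★★★ **THE LABEL CLASS OF THE DRESSED TOWER AT A LIVE-PINNED STAGE-9 TUPLE.**  For `ϑ` with `ϑ.ppSel = ppSelLiveOfRecord E (wOfRecord₉ ϑ)` and the same provisos: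
`Σ_{s′ ∈ S_C(s)} cw_{k+1}(s′) ≤ ∫ χ_k(s)(U)·slot^{t}_k(s)(U)·Π_{□∈C}(1 − χ_□(avg U)) dU` — the class weights and the slots at the live re-pin ARE those at the identity re-pin
(n19's `classWeightOfDatum₉_ppSelLive_eq_ppSelId`, `dressedSlotsOfDatum₉_ppSelLive_eq_ppSelId`), where `…_of_ppSelId` applies. [bookkeeping] -/
theorem sum_labelClass_classWeightOfDatum₉_succ_le_of_ppSelLive (ϑ : Stage9Params F N) (E : B12.RunParams → ℝ)
    (hsel : ϑ.ppSel = ppSelLiveOfRecord F N ϑ.ν ϑ.τ9 E (wOfRecord₉ F N ϑ))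
    (hU : LocalBgMeasurable F N ϑ.ν) (hζu : IsZetaUnity F N ϑ.ν ϑ.τ9.M ϑ.ζ) (hζa : IsZetaAbsLeOne F N ϑ.ν ϑ.τ9.M ϑ.ζ)
    (hζm : ZetaMeasurable F N ϑ.ζ) (hζ0 : ∀ p g k s Pl Ql RS U V', 0 ≤ ϑ.ζ p g k s Pl Ql RS U V')
    (D : FiniteEpsData F (SU N)) (hD : D.AvgMeasurable) (g₀ : ℕ → ℝ) (os : List (ULoop F)) (p : B12.RunParams) (g : ℕ → ℝ) (hg : g 0 = g₀ p.K)
    (k : ℕ) (hk : k < p.K) (t : ℝ) (s : SeqOfRecord F ϑ.ν ϑ.τ9.M g p.K k) (C : Finset (Iχ F ϑ.ν p g k)) (hC : C ⊆ cubes32 F ϑ.ν ϑ.τ9.M p g k s) :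
    ∑ s' ∈ Finset.univ.filter (fun s' : SeqOfRecord F ϑ.ν ϑ.τ9.M g p.K (k + 1) =>
        s'.init = s ∧ ∀ lb : LbOfRecord F ϑ.ν p g k, σOfRecord F ϑ.ν ϑ.τ9.M p g k s lb = s' → C ⊆ lb.1),
        classWeightOfDatum₉ F N ϑ D g₀ os p g (k + 1) t s'
      ≤ ∫ U, chiSeqOfRecord F N ϑ.ν ϑ.τ9.M g p.K k s U * dressedSlotsOfDatum₉ F N ϑ D g₀ os t p g k s U *
          ∏ c ∈ C, (1 - chiFactor F N ϑ.ν p g k c ((avOfRecord F N p.K k).avg U)) ∂(fieldMeasure (F.P p.K) k (SU N)) := by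
  have hw0 : ∀ k s' U V', 0 ≤ wOfRecord₉ F N ϑ p g k s' U V' := fun k s' U V' => wOfRecord_nonneg F N ϑ.ν ϑ.τ9.M p g k ϑ.A₁ hζ0 s' U V'
  have hwm : ∀ k s', Measurable (fun z : GaugeField (F.P p.K) (k + 1) (SU N) × GaugeField (F.P p.K) k (SU N) => wOfRecord₉ F N ϑ p g k s' z.2 z.1) :=
    fun k s' => measurable_wOfRecord_of_localBg hU ϑ.τ9.M ϑ.A₁ hζm p g k s'
  have hχm : ∀ k s, Measurable (chiSeqOfRecord F N ϑ.ν ϑ.τ9.M g p.K k s) := fun k s => measurable_chiSeqOfRecord_of_localBg hU ϑ.τ9.M g p.K k s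
  -- the identity re-pin: class weights and slots agree (n19's tower identity)
  have hcw := fun k t s => classWeightOfDatum₉_ppSelLive_eq_ppSelId F N ϑ D g₀ os p g E hsel hg hD hw0 hwm hχm k t s
  have hsl := dressedSlotsOfDatum₉_ppSelLive_eq_ppSelId F N ϑ D g₀ os p g E hsel hg hD hw0 hwm hχm t
  rw [Finset.sum_congr rfl fun s' _ => hcw (k + 1) t s']
  rw [integral_congr_ae (ae_of_all _ fun U => congrArg (fun x : ℝ => chiSeqOfRecord F N ϑ.ν ϑ.τ9.M g p.K k s U * x *
      ∏ c ∈ C, (1 - chiFactor F N ϑ.ν p g k c ((avOfRecord F N p.K k).avg U))) (hsl k s U))]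
  exact sum_labelClass_classWeightOfDatum₉_succ_le_of_ppSelId { ϑ with ppSel := ppSelIdOfRecord F ϑ.ν ϑ.τ9.M } rfl hU hζu hζa hζm hζ0 D hD
    g₀ os p g hg k hk t s C hC

open scoped Classical in
/-- ★★★ **THE LABEL LETTER FROM THE LARGE-FIELD SUPPRESSION LETTER ALONE.**  Same tuple and provisos; GIVEN hLF at `(k, s, C, t)` — «under the class density `χ_k(s)·slot^{t}_k(s)` of
the history `s`, the (2.16) background of the averaged field violates the new small-field condition (3.2) on every cube of `C` with weight at most `δ`»:
`∫ χ_k(s)·slot_k(s)·Π_{□∈C}(1 − χ_□(avg U)) ≤ δ · ∫ χ_k(s)·slot_k(s)` — the label class weighs at most `δ · cw_k(s)`.  hLF is [LF-II] (1.79) p. 383's new-region factor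
(`δ = e^{−p₀(g_k)·|C|}` in print) READ on one history's class density: an ESTIMATE, nobody's theorem today. [bookkeeping] -/
theorem sum_labelClass_classWeightOfDatum₉_succ_le_of_largeFieldLetter_of_ppSelLive (ϑ : Stage9Params F N) (E : B12.RunParams → ℝ)
    (hsel : ϑ.ppSel = ppSelLiveOfRecord F N ϑ.ν ϑ.τ9 E (wOfRecord₉ F N ϑ))
    (hU : LocalBgMeasurable F N ϑ.ν) (hζu : IsZetaUnity F N ϑ.ν ϑ.τ9.M ϑ.ζ) (hζa : IsZetaAbsLeOne F N ϑ.ν ϑ.τ9.M ϑ.ζ)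
    (hζm : ZetaMeasurable F N ϑ.ζ) (hζ0 : ∀ p g k s Pl Ql RS U V', 0 ≤ ϑ.ζ p g k s Pl Ql RS U V')
    (D : FiniteEpsData F (SU N)) (hD : D.AvgMeasurable) (g₀ : ℕ → ℝ) (os : List (ULoop F)) (p : B12.RunParams) (g : ℕ → ℝ) (hg : g 0 = g₀ p.K)
    (k : ℕ) (hk : k < p.K) (t : ℝ) (s : SeqOfRecord F ϑ.ν ϑ.τ9.M g p.K k) (C : Finset (Iχ F ϑ.ν p g k)) (hC : C ⊆ cubes32 F ϑ.ν ϑ.τ9.M p g k s) {δ : ℝ}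
    (hLF : ∫ U, chiSeqOfRecord F N ϑ.ν ϑ.τ9.M g p.K k s U * dressedSlotsOfDatum₉ F N ϑ D g₀ os t p g k s U *
          ∏ c ∈ C, (1 - chiFactor F N ϑ.ν p g k c ((avOfRecord F N p.K k).avg U)) ∂(fieldMeasure (F.P p.K) k (SU N))
        ≤ δ * classWeightOfDatum₉ F N ϑ D g₀ os p g k t s) :
    ∑ s' ∈ Finset.univ.filter (fun s' : SeqOfRecord F ϑ.ν ϑ.τ9.M g p.K (k + 1) =>
        s'.init = s ∧ ∀ lb : LbOfRecord F ϑ.ν p g k, σOfRecord F ϑ.ν ϑ.τ9.M p g k s lb = s' → C ⊆ lb.1),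
        classWeightOfDatum₉ F N ϑ D g₀ os p g (k + 1) t s' ≤ δ * classWeightOfDatum₉ F N ϑ D g₀ os p g k t s :=
  (sum_labelClass_classWeightOfDatum₉_succ_le_of_ppSelLive ϑ E hsel hU hζu hζa hζm hζ0 D hD g₀ os p g hg k hk t s C hC).trans hLF

end Dressed

end YMDAG.UVSplit

end
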